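import Summits.CriticalPhenomena.PercolationContinuityZ3.Theorems.FK.DomainMarkovExtremalityLimits
import Summits.CriticalPhenomena.PercolationContinuityZ3.Theorems.FK.InfiniteVolumeLiteratureBridge
import Literature.Probability.LatticeModels.StochasticOrderCoupling
import HarnessLib

/-!
# FK-continuity transplant, FO-06 (interface half): the sandwich class is STOCHASTICALLY ORDERED —
# `φ⁰_{p,q} ≤st P ≤st φ¹_{p,q}` for every `FKGibbs d p q P` over ALL increasing measurable events; monotone
# couplings; the edge-density characterisation (Prop. (4.6)) and extremality (Thm. (4.34)(c)) of `φ⁰_{p,q}`, `φ¹_{p,q}`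

Cell `fk-continuity` (bschramm), registry row FO-06a-7; support file for the FK-continuity transplant
(`--supports stmt-CriticalPhenomena-4575`); builds on p205010 (kernel theorem, internal audit signed; external
expert review pending).  Pure proofs; no definitions, no named facts, no sorries.

Grimmett's extremality statements (4.21) (Thm. (4.19)(c), for the weak limits `W_{p,q}`) and (4.35) (Thm. (4.34)(b),
for the DLR measures `R_{p,q}`) say `φ⁰_{p,q} ≤st φ ≤st φ¹_{p,q}`, where `≤st` is the stochastic order of §2.1 /
§4.1 (4.1): `μ₁(X) ≤ μ₂(X)` for every increasing continuous `X` — equivalently (monotone class through (4.4)–(4.5),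
or Strassen's coupling [237, Thm II.2.4] as in the proof of Prop. (4.6)) `μ₁(U) ≤ μ₂(U)` for EVERY increasing
measurable event `U` and `∫ f dμ₁ ≤ ∫ f dμ₂` for every bounded increasing measurable `f`.  Row FO-10a typed the
sandwich of the tree's class `FKGibbs d p q` (the free/wired
sandwich form of the DLR property, `InfiniteVolumeGibbs.lean`) against the box limits on increasing LOCAL events
(`FKGibbs.isBoxLimit_real_le_of_determinedBy_sym2`, `FKGibbs.rcLimit_false_real_le`, …) and, at `θ`-level, on the
one-arm / percolation events (`GibbsThetaSandwich.lean`).  This file closes the gap to Grimmett's own strength in the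
hub's stochastic-order vocabulary `Literature.Probability.LatticeModels.mStLe` (`StochasticOrder.lean`: `mStLe μ ν`
iff `μ U ≤ ν U` for every measurable up-set `U`), through the tree theorem that increasing local events suffice for
random subsets of a countable set (`mStLe_of_isLocalEvent`, Grimmett's (4.1)–(4.5) / Prop. 4.10):

* `FKGibbs.mStLe_of_isBoxLimit_false` / `…_true`, `FKGibbs.rcLimit_false_mStLe`, `FKGibbs.mStLe_rcLimit_true` —
  **`φ⁰_{p,q} ≤st P ≤st φ¹_{p,q}`** for every `FKGibbs d p q P` (`p ∈ [0,1]`, `q ≥ 1`); unpacked on measurable up-sets / down-sets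
  (`FKGibbs.rcLimit_false_le_of_isUpperSet`, …), on bounded increasing measurable functionals
  (`FKGibbs.integral_rcLimit_false_le`, `…integral_le_rcLimit_true`), on the non-local events "an infinite cluster exists",
  `{x ↔ y}`; the corollary `rcLimit_false_mStLe_rcLimit_true : φ⁰_{p,q} ≤st φ¹_{p,q}` (its Literature-vocabulary twin,
  with monotonicity in `p`, is prim-sahi's `SahiBoxTP2.isRandomClusterLimit_free_le_wired` / `…_mono_p` — not restated).
* `FKGibbs.exists_monotoneCoupling_rcLimit_false` / `…_true`, `exists_monotoneCoupling_rcLimit_false_true` — STRASSEN for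
  the class (pairs `ω₀ ⊆ ω` with marginals `φ⁰_{p,q}`, `P`, etc.), via the tree's `exists_monotoneCoupling_of_mStLe`.
* `FKGibbs.eq_rcLimit_false_of_forall_real_setOf_mem_le` / `FKGibbs.eq_rcLimit_true_of_forall_le_real_setOf_mem` —
  **Prop. (4.6) for the class**: a member whose edge densities do not exceed `h⁰(p,q)` IS `φ⁰_{p,q}`; one whose edge
  densities are at least `h¹(p,q)` IS `φ¹_{p,q}` (tree `eq_of_mStLe_of_forall_mem`).  A statement about an ARBITRARY
  member; its specialisation `P = φ¹_{p,q}` — `φ⁰_{p,q} = φ¹_{p,q}` iff `h⁰ = h¹`, Thm. (4.63) (c)⇔(d), and the countable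
  exceptional set — is registry row FO-07b (`FreeWiredCoincidence.lean`, fkp-07 lineage), neither stated nor derived here.
* `FKGibbs.eq_rcLimit_false_of_rcLimit_false_eq_add_smul` / `…true…` — **Thm. (4.34)(c): `φ⁰_{p,q}`, `φ¹_{p,q}` are
  EXTREME POINTS of the class**: `φ^b_{p,q} = s • μ + t • ν` with `μ, ν` members and `s, t ≠ 0` forces `μ = ν = φ^b_{p,q}`
  (the order forces equal one-edge marginals, then Prop. (4.6)).
* `mStLe_of_isFKGibbs_of_isRandomClusterLimit_free` / `…_wired` — the order in the Literature vocabulary (`IsFKGibbs`,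
  `IsRandomClusterLimit`; transport through `InfiniteVolumeLiteratureBridge.lean`), for prim-sahi.

Honest framing: this is banked GRC ch. 4 structure for prim-sahi / fk-ref FO-17; it is NOT an END-STATE dependency of
the cell (nothing here is consumed by the transplant's `_r3`), and it says nothing about FH / TP_FK / continuity at
`p_c(q)` — in particular nothing about whether `φ⁰_{p,q} = φ¹_{p,q}` at any given `p`.  Hypotheses are exactly
`p ∈ [0,1]`, `q ≥ 1` (and `0 < d` where the wired edge density needs it); no named fact, no definition.

## References

* G. Grimmett, *The Random-Cluster Model*, Springer 2006: §2.1 (stochastic ordering), §4.1 (4.1)–(4.5) and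
  Prop. (4.6) p. 68, Prop. (4.10)(a) p. 69, Thm. (4.19)(c) eq. (4.21) p. 76 (proof p. 77), Thm. (4.34)(b)(c)
  eq. (4.35) p. 81, (4.61) p. 88. [Grimmett2006]
* T. M. Liggett, *Interacting Particle Systems*, Springer 1985/2005: Thm. II.2.4 (Strassen). [Liggett2005]
-/

noncomputable section

open MeasureTheory Set Filter
open scoped Topology ENNReal

namespace Summit.CriticalPhenomena.PercolationContinuityZ3.Theorems.FK

open Literature.Probability.Percolation Literature.Probability.LatticeModels

variable {d : ℕ}

/-! ### A finite set of pairs of sites lies among the pairs of a box -/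

/-- Every finite set `T` of pairs of sites of `ℤ^d` is contained in the set of pairs of the box `Λ_n`,
`n = max_{e ∈ T} pairRad e`. [folklore] -/
theorem exists_coe_subset_sym2_box (T : Finset (Sym2 (Site d))) :
    ∃ n : ℕ, (↑T : Set (Sym2 (Site d))) ⊆ ↑((box d n).sym2) := by
  refine ⟨T.sup pairRad, fun e he => ?_⟩
  rw [Finset.mem_coe, Finset.mem_sym2_iff]
  exact mem_box_of_pairRad_le (Finset.le_sup (f := pairRad) (Finset.mem_coe.1 he))

/-- A local event of bond configurations of `ℤ^d` is determined by the pairs of some box. [folklore] -/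
theorem exists_determinedBy_sym2_box_of_isLocalEvent {A : Set (BondConfig (Site d))} (hA : IsLocalEvent A) :
    ∃ n : ℕ, DeterminedBy A ↑((box d n).sym2) := by
  obtain ⟨T, hAT⟩ := hA
  obtain ⟨n, hn⟩ := exists_coe_subset_sym2_box T
  exact ⟨n, hAT.mono hn⟩

namespace FKGibbs

variable {p q : ℝ} {P P₀ P₁ : Measure (BondConfig (Site d))}

/-! ### `φ⁰_{p,q} ≤st P ≤st φ¹_{p,q}` over all increasing measurable events (Grimmett 2006, (4.21)/(4.35)) -/

/-- **`P₀ ≤st P` for the free box limit `P₀` and every `P` of the sandwich class** (`p ∈ [0,1]`, `q ≥ 1`): Grimmett's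
(4.21)/(4.35), lower half, in the stochastic order of §2.1 — `P₀ U ≤ P U` for EVERY increasing measurable event `U`.
Increasing local events suffice (`mStLe_of_isLocalEvent`, (4.1)–(4.5)), and on those the inequality is FO-10a's
`FKGibbs.isBoxLimit_real_le_of_determinedBy_sym2`. [cite: Grimmett2006, Thm. (4.19)(c) eq. (4.21) and Thm. (4.34)(b) eq. (4.35)] -/
theorem mStLe_of_isBoxLimit_false (hP : FKGibbs d p q P) (hP₀ : IsBoxLimit d false p q P₀)
    (hp : p ∈ Set.Icc (0 : ℝ) 1) (hq : 1 ≤ q) : mStLe P₀ P := by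
  haveI := hP.isProbabilityMeasure; haveI := hP₀.isProbabilityMeasure
  refine mStLe_of_isLocalEvent fun A hA hAu => ?_
  obtain ⟨n, hAn⟩ := exists_determinedBy_sym2_box_of_isLocalEvent hA
  have h := hP.isBoxLimit_real_le_of_determinedBy_sym2 hP₀ (hP₀.ae_subset_edgeSet hp (one_pos.trans_le hq)) hAu hAn
  exact (ENNReal.toReal_le_toReal (measure_ne_top _ _) (measure_ne_top _ _)).1 h

/-- **`P ≤st P₁` for the wired box limit `P₁` and every `P` of the sandwich class** (`p ∈ [0,1]`, `q ≥ 1`): Grimmett's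
(4.21)/(4.35), upper half, over every increasing measurable event. [cite: Grimmett2006, Thm. (4.19)(c) eq. (4.21) and Thm. (4.34)(b) eq. (4.35)] -/
theorem mStLe_of_isBoxLimit_true (hP : FKGibbs d p q P) (hP₁ : IsBoxLimit d true p q P₁)
    (hp : p ∈ Set.Icc (0 : ℝ) 1) (hq : 1 ≤ q) : mStLe P P₁ := by
  haveI := hP.isProbabilityMeasure; haveI := hP₁.isProbabilityMeasure
  refine mStLe_of_isLocalEvent fun A hA hAu => ?_
  obtain ⟨n, hAn⟩ := exists_determinedBy_sym2_box_of_isLocalEvent hA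
  have h := hP.real_le_isBoxLimit_of_determinedBy_sym2 hP₁ (hP₁.ae_subset_edgeSet hp (one_pos.trans_le hq)) hAu hAn
  exact (ENNReal.toReal_le_toReal (measure_ne_top _ _) (measure_ne_top _ _)).1 h

/-- **`φ⁰_{p,q} ≤st P`** with the free limit by name (`rcLimit d false p q`), every `P` of the sandwich class,
`p ∈ [0,1]`, `q ≥ 1`. [cite: Grimmett2006, Thm. (4.19)(c) eq. (4.21) and Thm. (4.34)(b) eq. (4.35)] -/
theorem rcLimit_false_mStLe (hP : FKGibbs d p q P) (hp : p ∈ Set.Icc (0 : ℝ) 1) (hq : 1 ≤ q) :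
    mStLe (rcLimit d false p q) P :=
  hP.mStLe_of_isBoxLimit_false (isBoxLimit_rcLimit false hp hq) hp hq

/-- **`P ≤st φ¹_{p,q}`** with the wired limit by name (`rcLimit d true p q`), every `P` of the sandwich class,
`p ∈ [0,1]`, `q ≥ 1`. [cite: Grimmett2006, Thm. (4.19)(c) eq. (4.21) and Thm. (4.34)(b) eq. (4.35)] -/
theorem mStLe_rcLimit_true (hP : FKGibbs d p q P) (hp : p ∈ Set.Icc (0 : ℝ) 1) (hq : 1 ≤ q) :
    mStLe P (rcLimit d true p q) :=
  hP.mStLe_of_isBoxLimit_true (isBoxLimit_rcLimit true hp hq) hp hq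

/-! ### Unpacked: increasing and decreasing measurable events, bounded increasing functionals -/

/-- `φ⁰_{p,q}(U) ≤ P(U)` for every increasing measurable event `U` (values in `ℝ≥0∞`). [cite: Grimmett2006, Thm. (4.34)(b) eq. (4.35)] -/
theorem rcLimit_false_le_of_isUpperSet (hP : FKGibbs d p q P) (hp : p ∈ Set.Icc (0 : ℝ) 1) (hq : 1 ≤ q)
    {U : Set (BondConfig (Site d))} (hU : IsUpperSet U) (hUm : MeasurableSet U) :
    rcLimit d false p q U ≤ P U :=
  hP.rcLimit_false_mStLe hp hq hU hUm

/-- `P(U) ≤ φ¹_{p,q}(U)` for every increasing measurable event `U` (values in `ℝ≥0∞`). [cite: Grimmett2006, Thm. (4.34)(b) eq. (4.35)] -/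
theorem le_rcLimit_true_of_isUpperSet (hP : FKGibbs d p q P) (hp : p ∈ Set.Icc (0 : ℝ) 1) (hq : 1 ≤ q)
    {U : Set (BondConfig (Site d))} (hU : IsUpperSet U) (hUm : MeasurableSet U) :
    P U ≤ rcLimit d true p q U :=
  hP.mStLe_rcLimit_true hp hq hU hUm

/-- `φ⁰_{p,q}(U) ≤ P(U)` for every increasing measurable event `U`, real-valued. [cite: Grimmett2006, Thm. (4.34)(b) eq. (4.35)] -/
theorem rcLimit_false_real_le_of_measurableSet (hP : FKGibbs d p q P) (hp : p ∈ Set.Icc (0 : ℝ) 1) (hq : 1 ≤ q)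
    {U : Set (BondConfig (Site d))} (hU : IsUpperSet U) (hUm : MeasurableSet U) :
    (rcLimit d false p q).real U ≤ P.real U := by
  haveI := hP.isProbabilityMeasure
  exact ENNReal.toReal_mono (measure_ne_top _ _) (hP.rcLimit_false_le_of_isUpperSet hp hq hU hUm)

/-- `P(U) ≤ φ¹_{p,q}(U)` for every increasing measurable event `U`, real-valued. [cite: Grimmett2006, Thm. (4.34)(b) eq. (4.35)] -/
theorem real_le_rcLimit_true_of_measurableSet (hP : FKGibbs d p q P) (hp : p ∈ Set.Icc (0 : ℝ) 1) (hq : 1 ≤ q)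
    {U : Set (BondConfig (Site d))} (hU : IsUpperSet U) (hUm : MeasurableSet U) :
    P.real U ≤ (rcLimit d true p q).real U := by
  haveI := isProbabilityMeasure_rcLimit true p q (d := d)
  exact ENNReal.toReal_mono (measure_ne_top _ _) (hP.le_rcLimit_true_of_isUpperSet hp hq hU hUm)

/-- Decreasing measurable events: `P(D) ≤ φ⁰_{p,q}(D)`. [cite: Grimmett2006, Thm. (4.34)(b) eq. (4.35)] -/
theorem le_rcLimit_false_of_isLowerSet (hP : FKGibbs d p q P) (hp : p ∈ Set.Icc (0 : ℝ) 1) (hq : 1 ≤ q)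
    {D : Set (BondConfig (Site d))} (hD : IsLowerSet D) (hDm : MeasurableSet D) :
    P D ≤ rcLimit d false p q D := by
  haveI := hP.isProbabilityMeasure; haveI := isProbabilityMeasure_rcLimit false p q (d := d)
  exact (hP.rcLimit_false_mStLe hp hq).lowerSet_le (by rw [measure_univ, measure_univ]) hD hDm

/-- Decreasing measurable events: `φ¹_{p,q}(D) ≤ P(D)`. [cite: Grimmett2006, Thm. (4.34)(b) eq. (4.35)] -/
theorem rcLimit_true_le_of_isLowerSet (hP : FKGibbs d p q P) (hp : p ∈ Set.Icc (0 : ℝ) 1) (hq : 1 ≤ q)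
    {D : Set (BondConfig (Site d))} (hD : IsLowerSet D) (hDm : MeasurableSet D) :
    rcLimit d true p q D ≤ P D := by
  haveI := hP.isProbabilityMeasure; haveI := isProbabilityMeasure_rcLimit true p q (d := d)
  exact (hP.mStLe_rcLimit_true hp hq).lowerSet_le (by rw [measure_univ, measure_univ]) hD hDm

/-- **`∫ f dφ⁰_{p,q} ≤ ∫ f dP` for every bounded increasing measurable functional `f`** (Grimmett's §2.1 form of
`φ⁰_{p,q} ≤st P`). [cite: Grimmett2006, §2.1 and Thm. (4.34)(b) eq. (4.35)] -/
theorem integral_rcLimit_false_le (hP : FKGibbs d p q P) (hp : p ∈ Set.Icc (0 : ℝ) 1) (hq : 1 ≤ q)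
    {f : BondConfig (Site d) → ℝ} (hf : Monotone f) (hfm : Measurable f) {C : ℝ} (hfC : ∀ ω, |f ω| ≤ C) :
    ∫ ω, f ω ∂(rcLimit d false p q) ≤ ∫ ω, f ω ∂P := by
  haveI := hP.isProbabilityMeasure; haveI := isProbabilityMeasure_rcLimit false p q (d := d)
  exact (hP.rcLimit_false_mStLe hp hq).integral_le (by rw [measure_univ, measure_univ]) hfm hf hfC

/-- **`∫ f dP ≤ ∫ f dφ¹_{p,q}` for every bounded increasing measurable functional `f`.**
[cite: Grimmett2006, §2.1 and Thm. (4.34)(b) eq. (4.35)] -/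
theorem integral_le_rcLimit_true (hP : FKGibbs d p q P) (hp : p ∈ Set.Icc (0 : ℝ) 1) (hq : 1 ≤ q)
    {f : BondConfig (Site d) → ℝ} (hf : Monotone f) (hfm : Measurable f) {C : ℝ} (hfC : ∀ ω, |f ω| ≤ C) :
    ∫ ω, f ω ∂P ≤ ∫ ω, f ω ∂(rcLimit d true p q) := by
  haveI := hP.isProbabilityMeasure; haveI := isProbabilityMeasure_rcLimit true p q (d := d)
  exact (hP.mStLe_rcLimit_true hp hq).integral_le (by rw [measure_univ, measure_univ]) hfm hf hfC

/-! ### Two non-local increasing events: an infinite cluster exists; two sites are connected -/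

/-- **`φ⁰_{p,q}(∃ an infinite cluster) ≤ P(∃ an infinite cluster) ≤ φ¹_{p,q}(∃ an infinite cluster)`** for every `P`
of the sandwich class — an increasing event which is NOT local (indeed a tail event), so outside the scope of the
local-event sandwich. [cite: Grimmett2006, Thm. (4.34)(b) eq. (4.35)] -/
theorem real_setOf_exists_percolatesAt_mem_Icc (hP : FKGibbs d p q P) (hp : p ∈ Set.Icc (0 : ℝ) 1) (hq : 1 ≤ q) :
    P.real {ω | ∃ x, ω ∈ percolatesAt x} ∈
      Set.Icc ((rcLimit d false p q).real {ω | ∃ x, ω ∈ percolatesAt x})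
        ((rcLimit d true p q).real {ω | ∃ x, ω ∈ percolatesAt x}) := by
  have hU : IsUpperSet {ω : BondConfig (Site d) | ∃ x, ω ∈ percolatesAt x} :=
    fun _ _ hle ⟨x, hx⟩ => ⟨x, isUpperSet_percolatesAt x hle hx⟩
  have hUm : MeasurableSet {ω : BondConfig (Site d) | ∃ x, ω ∈ percolatesAt x} := by
    rw [show {ω : BondConfig (Site d) | ∃ x, ω ∈ percolatesAt x} = ⋃ x, percolatesAt x from
      Set.ext fun ω => by simp only [Set.mem_setOf_eq, Set.mem_iUnion]]
    exact MeasurableSet.iUnion fun x => measurableSet_percolatesAt_holds x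
  exact ⟨hP.rcLimit_false_real_le_of_measurableSet hp hq hU hUm, hP.real_le_rcLimit_true_of_measurableSet hp hq hU hUm⟩

/-- **Two-point connectivity: `φ⁰_{p,q}(x ↔ y) ≤ P(x ↔ y) ≤ φ¹_{p,q}(x ↔ y)`** for every `P` of the sandwich class
(`{x ↔ y}` is increasing but not local). [cite: Grimmett2006, Thm. (4.34)(b) eq. (4.35)] -/
theorem real_openConn_mem_Icc (hP : FKGibbs d p q P) (hp : p ∈ Set.Icc (0 : ℝ) 1) (hq : 1 ≤ q) (x y : Site d) :
    P.real (openConn x y) ∈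
      Set.Icc ((rcLimit d false p q).real (openConn x y)) ((rcLimit d true p q).real (openConn x y)) :=
  ⟨hP.rcLimit_false_real_le_of_measurableSet hp hq (isUpperSet_openConn x y) (measurableSet_openConn_holds x y),
    hP.real_le_rcLimit_true_of_measurableSet hp hq (isUpperSet_openConn x y) (measurableSet_openConn_holds x y)⟩

/-! ### Monotone couplings (Strassen) -/

/-- **Monotone coupling of `φ⁰_{p,q}` below `P`**: for every `P` of the sandwich class there is a probability measure
on pairs of configurations, supported on `{ω₀ ⊆ ω}`, with first marginal `φ⁰_{p,q}` and second marginal `P`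
(Strassen's theorem for random subsets of a countable set, applied to `φ⁰_{p,q} ≤st P`).
[cite: Grimmett2006, Thm. (4.34)(b) eq. (4.35)] [cite: Liggett2005, Thm. II.2.4] -/
theorem exists_monotoneCoupling_rcLimit_false (hP : FKGibbs d p q P) (hp : p ∈ Set.Icc (0 : ℝ) 1) (hq : 1 ≤ q) :
    ∃ π : Measure (BondConfig (Site d) × BondConfig (Site d)), IsProbabilityMeasure π ∧
      π.map Prod.fst = rcLimit d false p q ∧ π.map Prod.snd = P ∧ ∀ᵐ x ∂π, x.1 ⊆ x.2 := by
  haveI := hP.isProbabilityMeasure; haveI := isProbabilityMeasure_rcLimit false p q (d := d)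
  exact exists_monotoneCoupling_of_mStLe (hP.rcLimit_false_mStLe hp hq)

/-- **Monotone coupling of `P` below `φ¹_{p,q}`**: a probability measure on pairs `{ω ⊆ ω₁}` with marginals `P` and
`φ¹_{p,q}`. [cite: Grimmett2006, Thm. (4.34)(b) eq. (4.35)] [cite: Liggett2005, Thm. II.2.4] -/
theorem exists_monotoneCoupling_rcLimit_true (hP : FKGibbs d p q P) (hp : p ∈ Set.Icc (0 : ℝ) 1) (hq : 1 ≤ q) :
    ∃ π : Measure (BondConfig (Site d) × BondConfig (Site d)), IsProbabilityMeasure π ∧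
      π.map Prod.fst = P ∧ π.map Prod.snd = rcLimit d true p q ∧ ∀ᵐ x ∂π, x.1 ⊆ x.2 := by
  haveI := hP.isProbabilityMeasure; haveI := isProbabilityMeasure_rcLimit true p q (d := d)
  exact exists_monotoneCoupling_of_mStLe (hP.mStLe_rcLimit_true hp hq)

/-! ### Grimmett's Prop. (4.6) for the class: the extremal members are characterised by their edge densities -/

/-- A measure carried by lattice configurations gives probability `0` to "`e` is open" when `e` is not a lattice edge.
[cite: Grimmett2006, §4.2 (Ω = {0,1}^{E^d})] -/
theorem _root_.Summit.CriticalPhenomena.PercolationContinuityZ3.Theorems.FK.measure_setOf_mem_eq_zero_of_notMem_edgeSet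
    {μ : Measure (BondConfig (Site d))} (hμ : ∀ᵐ ω ∂μ, ω ⊆ (zdGraph d).edgeSet) {e : Sym2 (Site d)}
    (he : e ∉ (zdGraph d).edgeSet) : μ {ω | e ∈ ω} = 0 :=
  measure_mono_null (fun ω (heω : e ∈ ω) (hω : ω ⊆ (zdGraph d).edgeSet) => he (hω heω)) (ae_iff.1 hμ)

/-- **Prop. (4.6) for the class, free side**: a member `P` of the sandwich class whose edge densities do not exceed
the free densities, `P(e open) ≤ h⁰_{p,q}(e)` for every edge `e` of `ℤ^d`, IS the free measure `φ⁰_{p,q}`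
(`p ∈ [0,1]`, `q ≥ 1`).  Proof: `φ⁰_{p,q} ≤st P` and the one-edge marginals agree (`φ⁰_{p,q}(e open) = h⁰(e)`,
`IsBoxLimit.real_setOf_mem_eq_freeEdgeDensity`; non-edges are a.s. closed under both), so the two laws of random
edge sets coincide (`eq_of_mStLe_of_forall_mem`). [cite: Grimmett2006, Prop. (4.6) with Thm. (4.34)(b) eq. (4.35) and (4.61)] -/
theorem eq_rcLimit_false_of_forall_real_setOf_mem_le (hP : FKGibbs d p q P) (hp : p ∈ Set.Icc (0 : ℝ) 1)
    (hq : 1 ≤ q) (h : ∀ e ∈ (zdGraph d).edgeSet, P.real {ω | e ∈ ω} ≤ freeEdgeDensity d p q e) :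
    P = rcLimit d false p q := by
  haveI := hP.isProbabilityMeasure; haveI := isProbabilityMeasure_rcLimit false p q (d := d)
  have hq0 : 0 < q := one_pos.trans_le hq
  refine (eq_of_mStLe_of_forall_mem (hP.rcLimit_false_mStLe hp hq) fun e => ?_).symm
  by_cases he : e ∈ (zdGraph d).edgeSet
  · refine le_antisymm (hP.rcLimit_false_le_of_isUpperSet hp hq (fun ω ω' hle heω => hle heω)
      (measurableSet_of_isLocalEvent_holds (isLocalEvent_setOf_mem e))) ?_
    have h1 := (isBoxLimit_rcLimit false hp hq (d := d)).real_setOf_mem_eq_freeEdgeDensity hp hq e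
    exact (ENNReal.toReal_le_toReal (measure_ne_top _ _) (measure_ne_top _ _)).1 ((h e he).trans_eq h1.symm)
  · rw [measure_setOf_mem_eq_zero_of_notMem_edgeSet hP.ae_subset_edgeSet he,
      measure_setOf_mem_eq_zero_of_notMem_edgeSet ((isBoxLimit_rcLimit false hp hq).ae_subset_edgeSet hp hq0) he]

/-- **Prop. (4.6) for the class, wired side**: a member `P` of the sandwich class whose edge densities are at least
the wired densities, `h¹_{p,q}(e) ≤ P(e open)` for every edge `e` of `ℤ^d` (`d ≥ 1`), IS the wired measure `φ¹_{p,q}`.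
[cite: Grimmett2006, Prop. (4.6) with Thm. (4.34)(b) eq. (4.35) and (4.61)] -/
theorem eq_rcLimit_true_of_forall_le_real_setOf_mem (hP : FKGibbs d p q P) (hd : 0 < d) (hp : p ∈ Set.Icc (0 : ℝ) 1)
    (hq : 1 ≤ q) (h : ∀ e ∈ (zdGraph d).edgeSet, wiredEdgeDensity d p q e ≤ P.real {ω | e ∈ ω}) :
    P = rcLimit d true p q := by
  haveI := hP.isProbabilityMeasure; haveI := isProbabilityMeasure_rcLimit true p q (d := d)
  have hq0 : 0 < q := one_pos.trans_le hq
  refine eq_of_mStLe_of_forall_mem (hP.mStLe_rcLimit_true hp hq) fun e => ?_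
  by_cases he : e ∈ (zdGraph d).edgeSet
  · refine le_antisymm (hP.le_rcLimit_true_of_isUpperSet hp hq (fun ω ω' hle heω => hle heω)
      (measurableSet_of_isLocalEvent_holds (isLocalEvent_setOf_mem e))) ?_
    have h1 := (isBoxLimit_rcLimit true hp hq (d := d)).real_setOf_mem_eq_wiredEdgeDensity hd hp hq e
    exact (ENNReal.toReal_le_toReal (measure_ne_top _ _) (measure_ne_top _ _)).1 (h1.trans_le (h e he))
  · rw [measure_setOf_mem_eq_zero_of_notMem_edgeSet hP.ae_subset_edgeSet he,
      measure_setOf_mem_eq_zero_of_notMem_edgeSet ((isBoxLimit_rcLimit true hp hq).ae_subset_edgeSet hp hq0) he]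

/-! ### Extreme points (Grimmett 2006, Thm. (4.34)(c)) -/

/-- Arithmetic core of the extreme-point argument (local helper): a convex combination with positive weights of two
numbers that both dominate it equals each of them. [folklore] -/
private theorem eq_of_eq_convexCombination_of_le
    {a b c s t : ℝ} (hs : 0 < s) (ht : 0 < t) (hst : s + t = 1) (h : a = s * b + t * c) (hab : a ≤ b)
    (hac : a ≤ c) : b = a ∧ c = a := by
  have e : s * (b - a) + t * (c - a) = 0 := by linear_combination (-1 : ℝ) * h - a * hst
  have h1 : 0 ≤ s * (b - a) := mul_nonneg hs.le (sub_nonneg.2 hab)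
  have h2 : 0 ≤ t * (c - a) := mul_nonneg ht.le (sub_nonneg.2 hac)
  constructor
  · nlinarith [mul_pos hs (show (0:ℝ) < 1 from one_pos)]
  · nlinarith [mul_pos ht (show (0:ℝ) < 1 from one_pos)]

/-- Local helper: the weights of a convex decomposition `ρ = s • μ + t • ν` of a probability measure into probability
measures are finite and sum to `1` (so `s = ⊤` or `t = ⊤` never occurs); evaluation in `ℝ`. [folklore] -/
private theorem toReal_apply_of_eq_add_smul
    {ρ μ ν : Measure (BondConfig (Site d))} [IsProbabilityMeasure ρ] [IsProbabilityMeasure μ]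
    [IsProbabilityMeasure ν] {s t : ℝ≥0∞} (h : ρ = s • μ + t • ν) :
    s ≠ ∞ ∧ t ≠ ∞ ∧ s.toReal + t.toReal = 1 ∧ ∀ U : Set (BondConfig (Site d)),
      (ρ U).toReal = s.toReal * (μ U).toReal + t.toReal * (ν U).toReal := by
  have hU : ∀ U : Set (BondConfig (Site d)), ρ U = s * μ U + t * ν U := fun U => by
    rw [h, Measure.add_apply, Measure.smul_apply, Measure.smul_apply, smul_eq_mul, smul_eq_mul]
  have hst : s + t = 1 := by simpa [measure_univ] using (hU Set.univ).symm
  have hs1 : s ≠ ∞ := ne_top_of_le_ne_top ENNReal.one_ne_top (hst ▸ le_self_add)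
  have ht1 : t ≠ ∞ := ne_top_of_le_ne_top ENNReal.one_ne_top (hst ▸ le_add_self)
  refine ⟨hs1, ht1, by simpa [ENNReal.toReal_add hs1 ht1] using congrArg ENNReal.toReal hst, fun U => ?_⟩
  rw [hU U, ENNReal.toReal_add (ENNReal.mul_ne_top hs1 (measure_ne_top _ _))
    (ENNReal.mul_ne_top ht1 (measure_ne_top _ _)), ENNReal.toReal_mul, ENNReal.toReal_mul]

/-- **Thm. (4.34)(c), free side: `φ⁰_{p,q}` is an EXTREME POINT of the sandwich class** — if
`φ⁰_{p,q} = s • μ + t • ν` with `μ`, `ν` in the class and non-zero weights `s, t : ℝ≥0∞`, then `μ = ν = φ⁰_{p,q}`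
(`φ⁰ ≤st μ, ν` forces equality on every increasing event, in particular on the one-edge marginals; then Prop. (4.6)).
The weights automatically satisfy `s + t = 1` (evaluate at `univ`), so the corner `s = ⊤` or `t = ⊤` makes the
hypothesis `h` false and carries no content. [cite: Grimmett2006, Thm. (4.34)(c) with eq. (4.35) and Prop. (4.6)] -/
theorem eq_rcLimit_false_of_rcLimit_false_eq_add_smul {μ ν : Measure (BondConfig (Site d))} (hμ : FKGibbs d p q μ)
    (hν : FKGibbs d p q ν) (hp : p ∈ Set.Icc (0 : ℝ) 1) (hq : 1 ≤ q) {s t : ℝ≥0∞} (hs : s ≠ 0) (ht : t ≠ 0)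
    (h : rcLimit d false p q = s • μ + t • ν) : μ = rcLimit d false p q ∧ ν = rcLimit d false p q := by
  haveI := hμ.isProbabilityMeasure; haveI := hν.isProbabilityMeasure
  haveI := isProbabilityMeasure_rcLimit false p q (d := d)
  obtain ⟨hs1, ht1, hst, hU⟩ := toReal_apply_of_eq_add_smul h
  have hs' : 0 < s.toReal := ENNReal.toReal_pos hs hs1
  have ht' : 0 < t.toReal := ENNReal.toReal_pos ht ht1
  have key : ∀ U : Set (BondConfig (Site d)), IsUpperSet U → MeasurableSet U →
      μ U = rcLimit d false p q U ∧ ν U = rcLimit d false p q U := fun U hUu hUm => by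
    have hr := eq_of_eq_convexCombination_of_le hs' ht' hst (hU U)
      (ENNReal.toReal_mono (measure_ne_top _ _) (hμ.rcLimit_false_le_of_isUpperSet hp hq hUu hUm))
      (ENNReal.toReal_mono (measure_ne_top _ _) (hν.rcLimit_false_le_of_isUpperSet hp hq hUu hUm))
    exact ⟨(ENNReal.toReal_eq_toReal_iff' (measure_ne_top _ _) (measure_ne_top _ _)).1 hr.1,
      (ENNReal.toReal_eq_toReal_iff' (measure_ne_top _ _) (measure_ne_top _ _)).1 hr.2⟩
  have hmem : ∀ e : Sym2 (Site d), IsUpperSet {ω : BondConfig (Site d) | e ∈ ω} ∧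
      MeasurableSet {ω : BondConfig (Site d) | e ∈ ω} :=
    fun e => ⟨fun _ _ hle heω => hle heω, measurableSet_of_isLocalEvent_holds (isLocalEvent_setOf_mem e)⟩
  exact ⟨(eq_of_mStLe_of_forall_mem (hμ.rcLimit_false_mStLe hp hq) fun e =>
      ((key _ (hmem e).1 (hmem e).2).1).symm).symm,
    (eq_of_mStLe_of_forall_mem (hν.rcLimit_false_mStLe hp hq) fun e =>
      ((key _ (hmem e).1 (hmem e).2).2).symm).symm⟩

/-- **Thm. (4.34)(c), wired side: `φ¹_{p,q}` is an EXTREME POINT of the sandwich class** — if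
`φ¹_{p,q} = s • μ + t • ν` with `μ`, `ν` in the class and non-zero weights (hence `s + t = 1`; `s = ⊤` or `t = ⊤` is
impossible), then `μ = ν = φ¹_{p,q}`. [cite: Grimmett2006, Thm. (4.34)(c) with eq. (4.35) and Prop. (4.6)] -/
theorem eq_rcLimit_true_of_rcLimit_true_eq_add_smul {μ ν : Measure (BondConfig (Site d))} (hμ : FKGibbs d p q μ)
    (hν : FKGibbs d p q ν) (hp : p ∈ Set.Icc (0 : ℝ) 1) (hq : 1 ≤ q) {s t : ℝ≥0∞} (hs : s ≠ 0) (ht : t ≠ 0)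
    (h : rcLimit d true p q = s • μ + t • ν) : μ = rcLimit d true p q ∧ ν = rcLimit d true p q := by
  haveI := hμ.isProbabilityMeasure; haveI := hν.isProbabilityMeasure
  haveI := isProbabilityMeasure_rcLimit true p q (d := d)
  obtain ⟨hs1, ht1, hst, hU⟩ := toReal_apply_of_eq_add_smul h
  have hs' : 0 < s.toReal := ENNReal.toReal_pos hs hs1
  have ht' : 0 < t.toReal := ENNReal.toReal_pos ht ht1
  have key : ∀ U : Set (BondConfig (Site d)), IsUpperSet U → MeasurableSet U →
      μ U = rcLimit d true p q U ∧ ν U = rcLimit d true p q U := fun U hUu hUm => by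
    have hr := eq_of_eq_convexCombination_of_le (a := -((rcLimit d true p q) U).toReal) (b := -(μ U).toReal)
      (c := -(ν U).toReal) hs' ht' hst (by rw [hU U]; ring)
      (neg_le_neg (ENNReal.toReal_mono (measure_ne_top _ _) (hμ.le_rcLimit_true_of_isUpperSet hp hq hUu hUm)))
      (neg_le_neg (ENNReal.toReal_mono (measure_ne_top _ _) (hν.le_rcLimit_true_of_isUpperSet hp hq hUu hUm)))
    exact ⟨(ENNReal.toReal_eq_toReal_iff' (measure_ne_top _ _) (measure_ne_top _ _)).1 (neg_injective hr.1),
      (ENNReal.toReal_eq_toReal_iff' (measure_ne_top _ _) (measure_ne_top _ _)).1 (neg_injective hr.2)⟩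
  have hmem : ∀ e : Sym2 (Site d), IsUpperSet {ω : BondConfig (Site d) | e ∈ ω} ∧
      MeasurableSet {ω : BondConfig (Site d) | e ∈ ω} :=
    fun e => ⟨fun _ _ hle heω => hle heω, measurableSet_of_isLocalEvent_holds (isLocalEvent_setOf_mem e)⟩
  exact ⟨eq_of_mStLe_of_forall_mem (hμ.mStLe_rcLimit_true hp hq) fun e => (key _ (hmem e).1 (hmem e).2).1,
    eq_of_mStLe_of_forall_mem (hν.mStLe_rcLimit_true hp hq) fun e => (key _ (hmem e).1 (hmem e).2).2⟩

end FKGibbs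

/-! ### Corollaries for the two limits themselves -/

/-- **`φ⁰_{p,q} ≤st φ¹_{p,q}`** over all increasing measurable events (`p ∈ [0,1]`, `q ≥ 1`): the wired limit is a
member of the sandwich class (`IsBoxLimit.fkGibbs`).  (In the Literature vocabulary `IsRandomClusterLimit`, with
monotonicity in `p` as well, this is prim-sahi's `SahiBoxTP2.isRandomClusterLimit_free_le_wired`.)
[cite: Grimmett2006, Thm. (4.19)(c) eq. (4.21)] -/
theorem rcLimit_false_mStLe_rcLimit_true {p q : ℝ} (hp : p ∈ Set.Icc (0 : ℝ) 1) (hq : 1 ≤ q) :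
    mStLe (rcLimit d false p q) (rcLimit d true p q) :=
  ((isBoxLimit_rcLimit true hp hq).fkGibbs hp hq).rcLimit_false_mStLe hp hq

/-- **Monotone coupling of the free and wired limits**: a probability measure on pairs `{ω₀ ⊆ ω₁}` with marginals
`φ⁰_{p,q}`, `φ¹_{p,q}` (`p ∈ [0,1]`, `q ≥ 1`). [cite: Grimmett2006, Thm. (4.19)(c) eq. (4.21)] [cite: Liggett2005, Thm. II.2.4] -/
theorem exists_monotoneCoupling_rcLimit_false_true {p q : ℝ} (hp : p ∈ Set.Icc (0 : ℝ) 1) (hq : 1 ≤ q) :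
    ∃ π : Measure (BondConfig (Site d) × BondConfig (Site d)), IsProbabilityMeasure π ∧
      π.map Prod.fst = rcLimit d false p q ∧ π.map Prod.snd = rcLimit d true p q ∧ ∀ᵐ x ∂π, x.1 ⊆ x.2 :=
  ((isBoxLimit_rcLimit true hp hq).fkGibbs hp hq).exists_monotoneCoupling_rcLimit_false hp hq

/-! ### Literature vocabulary (`IsFKGibbs`, `IsRandomClusterLimit`) -/

/-- **`φ⁰_{p,q} ≤st P` in the Literature vocabulary**: for `P` satisfying the Literature hypothesis structure
`IsFKGibbs d p q P` and `P₀` the free Literature limit `IsRandomClusterLimit d free p q P₀` (`p ∈ [0,1]`, `q ≥ 1`),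
`P₀ ≤st P` over all increasing measurable events. [cite: Grimmett2006, Thm. (4.34)(b) eq. (4.35)] -/
theorem mStLe_of_isFKGibbs_of_isRandomClusterLimit_free {p q : ℝ} {P P₀ : Measure (BondConfig (Site d))}
    (hG : IsFKGibbs d p q P) (hP₀ : IsRandomClusterLimit d RCBoundary.free p q P₀) (hp : p ∈ Set.Icc (0 : ℝ) 1)
    (hq : 1 ≤ q) : mStLe P₀ P :=
  (fkGibbs_of_isFKGibbs hG).mStLe_of_isBoxLimit_false ((isBoxLimit_iff_isRandomClusterLimit (b := false)).2 hP₀) hp hq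

/-- **`P ≤st φ¹_{p,q}` in the Literature vocabulary**: `IsFKGibbs d p q P` and the wired Literature limit
`IsRandomClusterLimit d wired p q P₁` give `P ≤st P₁`. [cite: Grimmett2006, Thm. (4.34)(b) eq. (4.35)] -/
theorem mStLe_of_isFKGibbs_of_isRandomClusterLimit_wired {p q : ℝ} {P P₁ : Measure (BondConfig (Site d))}
    (hG : IsFKGibbs d p q P) (hP₁ : IsRandomClusterLimit d RCBoundary.wired p q P₁) (hp : p ∈ Set.Icc (0 : ℝ) 1)
    (hq : 1 ≤ q) : mStLe P P₁ :=
  (fkGibbs_of_isFKGibbs hG).mStLe_of_isBoxLimit_true ((isBoxLimit_iff_isRandomClusterLimit (b := true)).2 hP₁) hp hq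

end Summit.CriticalPhenomena.PercolationContinuityZ3.Theorems.FK

end
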